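import Summits.ResolutionOfSingularities.ResolutionOfSingularities.Theorems.WildConesCampaignW46HypersurfacesCharTwoEmbDimDynamics
import Summits.ResolutionOfSingularities.ResolutionOfSingularities.Theorems.WildConesCampaignW46HypersurfacesCharTwoFourfoldNonClosure

/-!
# [OURS · L1 W4.6, rung (ii) at p = 2, HONEST SCOPE MARKER] Embedding dimension TWO is genuinely undecided:
# two isolated fourfold double points with `e = 2`, one with an ISOLATED double successor
# (`u₀u₁ + u₂²u₃ + u₂u₃²`), one with a NON-isolated one (`u₀u₁ + u₂⁵ + u₃⁵`, p485483) — every field of char 2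

HONEST FRAMING. Everything here is OURS: an explicit computation in route WildCones' TYPED point-blow-up
dynamics (`Theorems/WildConesClassicalRegimesDefs.lean`), in the pattern of the seat's gen-2 scope marker
`…HypersurfacesCharTwoFourfoldNonClosure.lean` (p485483, whose lemmas are reused for the second witness), with
the seat's invariant `milnorEmbDim` (p498937). It pins down the one value the every-dimension trichotomy
(`hypersurface_trichotomy`, p501990: `e ≤ 1 ⇒` the double successor is isolated, `e ≥ 3 ⇒` it is not) leaves
open. NOTHING here is a statement of the manuscript [Hironaka2017]; no FACT-LIST premise; AI review is weaker
than expert review. Cell res-hironaka (LADDER-RESOLUTION rung L, D-0089), slot W4.6, seat res-L1-s46-pv-4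
(gen 3); host route `WildCones`, crux `ClassicalRegimes` (stmt-ResolutionOfSingularities-16884; proved).

WHAT IS PROVED (every field of characteristic `2`):

* the start state `a = u₀u₁ + u₂²u₃ + u₂u₃²` (`n = 4`): double point, order-2 cleaned, ISOLATED
  (`(∂a) = (u₁, u₀, u₃², u₂²) ⊇ 𝔪³`), and `e(a) = 2` (`fourfold_milnorEmbDim_eq_two_of_double_successor`:
  `OrdP ⇒ e ≤ 2`, parity, and `e = 0` would forbid double successors);
* its successor in chart `u₂` without translation has cleaned series `u₀u₁ + u₂u₃ + u₂u₃²`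
  (`ser_step_of_ser_eq_fourMixed`), a double point that IS isolated — `(∂a') = (u₁, u₀, u₃(1+u₃), u₂) = 𝔪`,
  `μ = 1` (`isol_step_fourMixed`);
* `fourfold_embDim_two_undecided` — the two witnesses side by side (the second from p485483).

References: res-L1-s46-pv-4 gen 2, p485483; G.-M. Greuel, G. Pfister, J. Algebra 689 (2026) [GreuelPfister2026]
(context); H. Hironaka, ms. 2017 [Hironaka2017] — nothing of it is used.
-/

noncomputable section

-- single-problem summit: the doubled namespace component `ResolutionOfSingularities` is forced
set_option linter.dupNamespace false

open scoped BigOperators Classical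

open MvPowerSeries IsLocalRing

open Literature.AlgebraicGeometry.Resolution

namespace Summit.ResolutionOfSingularities.ResolutionOfSingularities.Theorems

namespace CampaignW46.HypersurfacesCharTwo

open WildCones WildCones.MuDropCharTwoOrdP ThreefoldsCharTwo

variable {κ : Type} [Field κ]

/-! ## The start state `u₀u₁ + u₂²u₃ + u₂u₃²` -/

/-- Coefficients of `X₀X₁ + X₂²X₃ + X₂X₃²`. [folklore] -/
theorem coeff_fourMixed (A : Fin 4 →₀ ℕ) :
    coeff A ((X 0 * X 1 + X 2 ^ 2 * X 3 + X 2 * X 3 ^ 2 : MvPowerSeries (Fin 4) κ)) =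
      (if A = Finsupp.single 0 1 + Finsupp.single 1 1 then 1 else 0) +
        (if A = Finsupp.single 2 2 + Finsupp.single 3 1 then 1 else 0) +
        (if A = Finsupp.single 2 1 + Finsupp.single 3 2 then 1 else 0) := by
  rw [map_add, map_add, X_pow_eq, X_pow_eq, X_def, X_def, X_def, X_def, monomial_mul_monomial,
    monomial_mul_monomial, monomial_mul_monomial, one_mul, coeff_monomial, coeff_monomial,
    coeff_monomial]

/-- The start series has no monomial with all exponents even. [folklore] -/
theorem fourMixed_coeff_eq_zero_of_even (A : Fin 4 →₀ ℕ) (hA : ∀ j, 2 ∣ A j) :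
    coeff A ((X 0 * X 1 + X 2 ^ 2 * X 3 + X 2 * X 3 ^ 2 : MvPowerSeries (Fin 4) κ)) = 0 := by
  rw [coeff_fourMixed]
  have h0 : A ≠ Finsupp.single 0 1 + Finsupp.single 1 1 := by
    rintro rfl; have := hA 0; simp at this
  have h1 : A ≠ Finsupp.single 2 2 + Finsupp.single 3 1 := by
    rintro rfl; have := hA 3; simp at this
  have h2 : A ≠ Finsupp.single 2 1 + Finsupp.single 3 2 := by
    rintro rfl; have := hA 2; simp at this
  rw [if_neg h0, if_neg h1, if_neg h2]
  simp

/-- The pair coefficient `[X₀X₁]` of the start series is `1`. [folklore] -/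
theorem coeff_pair_fourMixed :
    coeff (Finsupp.single 0 1 + Finsupp.single 1 1)
      ((X 0 * X 1 + X 2 ^ 2 * X 3 + X 2 * X 3 ^ 2 : MvPowerSeries (Fin 4) κ)) = 1 := by
  rw [coeff_fourMixed, if_pos rfl]
  have h1 : (Finsupp.single 0 1 + Finsupp.single 1 1 : Fin 4 →₀ ℕ) ≠
      Finsupp.single 2 2 + Finsupp.single 3 1 := by
    intro h'; have := DFunLike.congr_fun h' 0; simp at this
  have h2 : (Finsupp.single 0 1 + Finsupp.single 1 1 : Fin 4 →₀ ℕ) ≠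
      Finsupp.single 2 1 + Finsupp.single 3 2 := by
    intro h'; have := DFunLike.congr_fun h' 0; simp at this
  rw [if_neg h1, if_neg h2]
  simp

/-- [OURS · L1 W4.6] A state (`n = 4`) with cleaned series `u₀u₁ + u₂²u₃ + u₂u₃²` is a double point. [folklore] -/
theorem multP_of_ser_eq_fourMixed {c : (Fin 4 → ℕ) → κ}
    (hc : ser 2 4 κ c = X 0 * X 1 + X 2 ^ 2 * X 3 + X 2 * X 3 ^ 2) : MultP 2 4 κ c := by
  rw [multP_iff_ser, hc]
  constructor
  · intro h
    have h1 := congrArg (coeff (Finsupp.single (0 : Fin 4) 1 + Finsupp.single 1 1)) h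
    rw [coeff_pair_fourMixed, map_zero] at h1
    exact one_ne_zero h1
  · refine nat_le_order fun d hd => ?_
    rw [coeff_fourMixed]
    have h0 : d ≠ Finsupp.single 0 1 + Finsupp.single 1 1 := by
      rintro rfl; simp only [map_add, Finsupp.degree_single] at hd; omega
    have h1 : d ≠ Finsupp.single 2 2 + Finsupp.single 3 1 := by
      rintro rfl; simp only [map_add, Finsupp.degree_single] at hd; omega
    have h2 : d ≠ Finsupp.single 2 1 + Finsupp.single 3 2 := by
      rintro rfl; simp only [map_add, Finsupp.degree_single] at hd; omega
    rw [if_neg h0, if_neg h1, if_neg h2]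
    simp

/-- [OURS · L1 W4.6] … and order-2 cleaned (`u₀u₁`). [folklore] -/
theorem ordP_of_ser_eq_fourMixed {c : (Fin 4 → ℕ) → κ}
    (hc : ser 2 4 κ c = X 0 * X 1 + X 2 ^ 2 * X 3 + X 2 * X 3 ^ 2) : OrdP 2 4 κ c := by
  rw [ordP_two_iff_exists_pair, hc]
  exact ⟨0, 1, by decide, by rw [coeff_pair_fourMixed]; exact one_ne_zero⟩

/-- In characteristic two: `∂₀ a = X₁`, `∂₁ a = X₀`, `∂₂ a = X₃²`, `∂₃ a = X₂²` for the start series.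
[folklore] -/
theorem pderiv_fourMixed [CharP κ 2] (s : Fin 4) :
    MvPowerSeries.pderiv s ((X 0 * X 1 + X 2 ^ 2 * X 3 + X 2 * X 3 ^ 2 : MvPowerSeries (Fin 4) κ)) =
      if s = 0 then X 1 else if s = 1 then X 0 else if s = 2 then X 3 ^ 2 else X 2 ^ 2 := by
  have h2 : (2 : MvPowerSeries (Fin 4) κ) = 0 := by
    rw [← map_ofNat (C : κ →+* _) 2, CharTwo.two_eq_zero, map_zero]
  rw [map_add, map_add, Derivation.leibniz, Derivation.leibniz, Derivation.leibniz,
    Derivation.leibniz_pow, Derivation.leibniz_pow, MvPowerSeries.pderiv_X, MvPowerSeries.pderiv_X,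
    MvPowerSeries.pderiv_X, MvPowerSeries.pderiv_X]
  fin_cases s <;> simp [smul_eq_mul, h2]

/-- `𝔪³ ≤ (∂a)` for the start series: a monomial of degree `3` in four variables is divisible by `X₀`, by
`X₁`, or by the square of `X₂` or `X₃`. [folklore] -/
theorem maximalIdeal_pow_three_le_jac_fourMixed [CharP κ 2] :
    maximalIdeal (MvPowerSeries (Fin 4) κ) ^ 3 ≤
      Ideal.span (Set.range fun s : Fin 4 =>
        MvPowerSeries.pderiv s ((X 0 * X 1 + X 2 ^ 2 * X 3 + X 2 * X 3 ^ 2 : MvPowerSeries (Fin 4) κ))) := by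
  rw [Literature.RingTheory.MvPowerSeries.Jets.maximalIdeal_pow_eq_span_monomial, Ideal.span_le]
  rintro _ ⟨e, he, rfl⟩
  change e.degree = 3 at he
  change (monomial e (1 : κ) : MvPowerSeries (Fin 4) κ) ∈ _
  have mem_of : ∀ (s : Fin 4) (k : ℕ), k ≤ e s →
      (∃ s', (X s : MvPowerSeries (Fin 4) κ) ^ k = MvPowerSeries.pderiv s'
        ((X 0 * X 1 + X 2 ^ 2 * X 3 + X 2 * X 3 ^ 2 : MvPowerSeries (Fin 4) κ))) →
      (monomial e (1 : κ) : MvPowerSeries (Fin 4) κ) ∈ Ideal.span (Set.range fun s : Fin 4 =>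
        MvPowerSeries.pderiv s ((X 0 * X 1 + X 2 ^ 2 * X 3 + X 2 * X 3 ^ 2 : MvPowerSeries (Fin 4) κ))) := by
    rintro s k hk ⟨s', h⟩
    have hdec : (monomial e (1 : κ) : MvPowerSeries (Fin 4) κ) =
        monomial (e - Finsupp.single s k) (1 : κ) * X s ^ k := by
      rw [X_pow_eq, monomial_mul_monomial, one_mul, tsub_add_cancel_of_le]
      intro t
      by_cases hts : t = s
      · subst hts; rwa [Finsupp.single_eq_same]
      · rw [Finsupp.single_apply, if_neg (Ne.symm hts)]; exact Nat.zero_le _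
    rw [hdec]
    exact Ideal.mul_mem_left _ _ (Ideal.subset_span ⟨s', h.symm⟩)
  by_cases h0 : 1 ≤ e 0
  · exact mem_of 0 1 h0 ⟨1, by rw [pderiv_fourMixed]; simp⟩
  by_cases h1 : 1 ≤ e 1
  · exact mem_of 1 1 h1 ⟨0, by rw [pderiv_fourMixed]; simp⟩
  have hsum : e.degree = e 0 + e 1 + e 2 + e 3 := by
    rw [degree_eq_sum_univ, Fin.sum_univ_four]
  by_cases h2 : 2 ≤ e 2
  · exact mem_of 2 2 h2 ⟨3, by rw [pderiv_fourMixed]; simp⟩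
  have h3 : 2 ≤ e 3 := by omega
  exact mem_of 3 2 h3 ⟨2, by rw [pderiv_fourMixed]; simp⟩

/-- [OURS · L1 W4.6] **The start state is ISOLATED**: `(∂a) ⊇ 𝔪³`. [folklore] -/
theorem isol_of_ser_eq_fourMixed [CharP κ 2] {c : (Fin 4 → ℕ) → κ}
    (hc : ser 2 4 κ c = X 0 * X 1 + X 2 ^ 2 * X 3 + X 2 * X 3 ^ 2) : Isol 2 4 κ c := by
  rw [isol_iff_finite_pderiv, hc]
  haveI := Literature.RingTheory.MvPowerSeries.Jets.finite_quotient_maximalIdeal_pow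
    (σ := Fin 4) (K := κ) 3
  exact Module.Finite.of_surjective
    (Ideal.Quotient.factorₐ κ maximalIdeal_pow_three_le_jac_fourMixed).toLinearMap
    (Ideal.Quotient.factor_surjective maximalIdeal_pow_three_le_jac_fourMixed)

/-! ## One step: chart `u₂`, no translation -/

/-- The blow-up substitution `Φ_{2,0}` on the start series: `a∘Φ = X₂² · (X₀X₁ + X₂X₃ + X₂X₃²)`.
[folklore] -/
theorem subst_blowFam_fourMixed :
    subst (fun s => if s = (2 : Fin 4) then (X 2 : MvPowerSeries (Fin 4) κ)
        else X 2 * (X s + C ((0 : Fin 4 → κ) s)))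
        ((X 0 * X 1 + X 2 ^ 2 * X 3 + X 2 * X 3 ^ 2 : MvPowerSeries (Fin 4) κ)) =
      X 2 ^ 2 * (X 0 * X 1 + X 2 * X 3 + X 2 * X 3 ^ 2) := by
  have ha := hasSubst_blowFam (κ := κ) (2 : Fin 4) (0 : Fin 4 → κ)
  rw [subst_add ha, subst_add ha, subst_mul ha, subst_mul ha, subst_mul ha, subst_pow ha, subst_pow ha,
    subst_X ha, subst_X ha, subst_X ha, subst_X ha]
  rw [if_neg (show (0 : Fin 4) ≠ 2 by decide), if_neg (show (1 : Fin 4) ≠ 2 by decide), if_pos rfl,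
    if_neg (show (3 : Fin 4) ≠ 2 by decide)]
  simp only [Pi.zero_apply, map_zero, add_zero]
  ring

/-- Coefficients of the successor series `X₀X₁ + X₂X₃ + X₂X₃²`. [folklore] -/
theorem coeff_fourMixedStep (A : Fin 4 →₀ ℕ) :
    coeff A ((X 0 * X 1 + X 2 * X 3 + X 2 * X 3 ^ 2 : MvPowerSeries (Fin 4) κ)) =
      (if A = Finsupp.single 0 1 + Finsupp.single 1 1 then 1 else 0) +
        (if A = Finsupp.single 2 1 + Finsupp.single 3 1 then 1 else 0) +
        (if A = Finsupp.single 2 1 + Finsupp.single 3 2 then 1 else 0) := by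
  rw [map_add, map_add, X_pow_eq, X_def, X_def, X_def, X_def, monomial_mul_monomial,
    monomial_mul_monomial, monomial_mul_monomial, one_mul, coeff_monomial, coeff_monomial,
    coeff_monomial]

/-- The successor series has no monomial with all exponents even. [folklore] -/
theorem fourMixedStep_coeff_eq_zero_of_even (A : Fin 4 →₀ ℕ) (hA : ∀ j, 2 ∣ A j) :
    coeff A ((X 0 * X 1 + X 2 * X 3 + X 2 * X 3 ^ 2 : MvPowerSeries (Fin 4) κ)) = 0 := by
  rw [coeff_fourMixedStep]
  have h0 : A ≠ Finsupp.single 0 1 + Finsupp.single 1 1 := by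
    rintro rfl; have := hA 0; simp at this
  have h1 : A ≠ Finsupp.single 2 1 + Finsupp.single 3 1 := by
    rintro rfl; have := hA 2; simp at this
  have h2 : A ≠ Finsupp.single 2 1 + Finsupp.single 3 2 := by
    rintro rfl; have := hA 2; simp at this
  rw [if_neg h0, if_neg h1, if_neg h2]
  simp

/-- The pair coefficient `[X₀X₁]` of the successor series is `1`. [folklore] -/
theorem coeff_pair_fourMixedStep :
    coeff (Finsupp.single 0 1 + Finsupp.single 1 1)
      ((X 0 * X 1 + X 2 * X 3 + X 2 * X 3 ^ 2 : MvPowerSeries (Fin 4) κ)) = 1 := by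
  rw [coeff_fourMixedStep, if_pos rfl]
  have h1 : (Finsupp.single 0 1 + Finsupp.single 1 1 : Fin 4 →₀ ℕ) ≠
      Finsupp.single 2 1 + Finsupp.single 3 1 := by
    intro h'; have := DFunLike.congr_fun h' 0; simp at this
  have h2 : (Finsupp.single 0 1 + Finsupp.single 1 1 : Fin 4 →₀ ℕ) ≠
      Finsupp.single 2 1 + Finsupp.single 3 2 := by
    intro h'; have := DFunLike.congr_fun h' 0; simp at this
  rw [if_neg h1, if_neg h2]
  simp

/-- [OURS · L1 W4.6] **The step on the start state**: the successor in chart `u₂` without translation has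
cleaned series `u₀u₁ + u₂u₃ + u₂u₃²`. [folklore] -/
theorem ser_step_of_ser_eq_fourMixed [CharP κ 2] {c : (Fin 4 → ℕ) → κ}
    (hc : ser 2 4 κ c = X 0 * X 1 + X 2 ^ 2 * X 3 + X 2 * X 3 ^ 2) :
    ser 2 4 κ (step 2 4 κ 2 0 c) = X 0 * X 1 + X 2 * X 3 + X 2 * X 3 ^ 2 := by
  have hM : MultP 2 4 κ c := multP_of_ser_eq_fourMixed hc
  have key := X_pow_mul_serT_eq_subst c 2 0 hM
  rw [hc, subst_blowFam_fourMixed] at key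
  have hX2 : (X 2 : MvPowerSeries (Fin 4) κ) ≠ 0 := fun h => by
    have h1 := congrArg (coeff (Finsupp.single (2 : Fin 4) 1)) h
    rw [coeff_index_single_self_X, map_zero] at h1
    exact one_ne_zero h1
  have hT := mul_left_cancel₀ (pow_ne_zero 2 hX2) key
  ext A
  rw [coeff_ser_step c 2 0 hM A]
  have hTA : tr 4 κ 2 0 2 (dv 4 κ 2 2 (bl 4 κ 2 (clean 2 4 κ c))) ⇑A =
      coeff A ((X 0 * X 1 + X 2 * X 3 + X 2 * X 3 ^ 2 : MvPowerSeries (Fin 4) κ)) := by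
    rw [← hT]; rfl
  have clean_apply : ∀ (g : (Fin 4 → ℕ) → κ) (B : Fin 4 → ℕ),
      clean 2 4 κ g B = @ite κ (∀ j, 2 ∣ B j) (Classical.dec _) 0 (g B) := fun _ _ => rfl
  rw [clean_apply]
  by_cases h : ∀ j, 2 ∣ (⇑A) j
  · rw [if_pos h, fourMixedStep_coeff_eq_zero_of_even A h]
  · rw [if_neg h, hTA]

/-- [OURS · L1 W4.6] The successor is a DOUBLE POINT. [folklore] -/
theorem multP_step_fourMixed [CharP κ 2] {c : (Fin 4 → ℕ) → κ}
    (hc : ser 2 4 κ c = X 0 * X 1 + X 2 ^ 2 * X 3 + X 2 * X 3 ^ 2) : MultP 2 4 κ (step 2 4 κ 2 0 c) := by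
  rw [multP_iff_ser, ser_step_of_ser_eq_fourMixed hc]
  constructor
  · intro h
    have h1 := congrArg (coeff (Finsupp.single (0 : Fin 4) 1 + Finsupp.single 1 1)) h
    rw [coeff_pair_fourMixedStep, map_zero] at h1
    exact one_ne_zero h1
  · refine nat_le_order fun d hd => ?_
    rw [coeff_fourMixedStep]
    have h0 : d ≠ Finsupp.single 0 1 + Finsupp.single 1 1 := by
      rintro rfl; simp only [map_add, Finsupp.degree_single] at hd; omega
    have h1 : d ≠ Finsupp.single 2 1 + Finsupp.single 3 1 := by
      rintro rfl; simp only [map_add, Finsupp.degree_single] at hd; omega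
    have h2 : d ≠ Finsupp.single 2 1 + Finsupp.single 3 2 := by
      rintro rfl; simp only [map_add, Finsupp.degree_single] at hd; omega
    rw [if_neg h0, if_neg h1, if_neg h2]
    simp

/-- In characteristic two: `∂₀ a' = X₁`, `∂₁ a' = X₀`, `∂₂ a' = X₃ + X₃²`, `∂₃ a' = X₂` for the successor
series. [folklore] -/
theorem pderiv_fourMixedStep [CharP κ 2] (s : Fin 4) :
    MvPowerSeries.pderiv s ((X 0 * X 1 + X 2 * X 3 + X 2 * X 3 ^ 2 : MvPowerSeries (Fin 4) κ)) =
      if s = 0 then X 1 else if s = 1 then X 0 else if s = 2 then X 3 + X 3 ^ 2 else X 2 := by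
  have h2 : (2 : MvPowerSeries (Fin 4) κ) = 0 := by
    rw [← map_ofNat (C : κ →+* _) 2, CharTwo.two_eq_zero, map_zero]
  rw [map_add, map_add, Derivation.leibniz, Derivation.leibniz, Derivation.leibniz,
    Derivation.leibniz_pow, MvPowerSeries.pderiv_X, MvPowerSeries.pderiv_X,
    MvPowerSeries.pderiv_X, MvPowerSeries.pderiv_X]
  fin_cases s <;> simp [smul_eq_mul, h2]

/-- Every variable lies in the gradient ideal of the successor series (`X₃ = (1 + X₃)⁻¹ ∂₂ a'`). [folklore] -/
theorem X_mem_jac_fourMixedStep [CharP κ 2] (s : Fin 4) :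
    (X s : MvPowerSeries (Fin 4) κ) ∈ Ideal.span (Set.range fun s : Fin 4 =>
      MvPowerSeries.pderiv s ((X 0 * X 1 + X 2 * X 3 + X 2 * X 3 ^ 2 : MvPowerSeries (Fin 4) κ))) := by
  have hmem : ∀ t : Fin 4, MvPowerSeries.pderiv t
      ((X 0 * X 1 + X 2 * X 3 + X 2 * X 3 ^ 2 : MvPowerSeries (Fin 4) κ)) ∈
      Ideal.span (Set.range fun s : Fin 4 =>
        MvPowerSeries.pderiv s ((X 0 * X 1 + X 2 * X 3 + X 2 * X 3 ^ 2 : MvPowerSeries (Fin 4) κ))) :=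
    fun t => Ideal.subset_span ⟨t, rfl⟩
  fin_cases s
  · have h := hmem 1
    rw [pderiv_fourMixedStep] at h
    simpa using h
  · have h := hmem 0
    rw [pderiv_fourMixedStep] at h
    simpa using h
  · have h := hmem 3
    rw [pderiv_fourMixedStep] at h
    simpa using h
  · have h : (X 3 + X 3 ^ 2 : MvPowerSeries (Fin 4) κ) ∈ Ideal.span (Set.range fun s : Fin 4 =>
        MvPowerSeries.pderiv s ((X 0 * X 1 + X 2 * X 3 + X 2 * X 3 ^ 2 : MvPowerSeries (Fin 4) κ))) := by
      have h := hmem 2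
      rw [pderiv_fourMixedStep] at h
      simpa using h
    have hu : IsUnit (1 + X 3 : MvPowerSeries (Fin 4) κ) := by
      rw [MvPowerSeries.isUnit_iff_constantCoeff, map_add, map_one, constantCoeff_X, add_zero]
      exact isUnit_one
    obtain ⟨u, hu'⟩ := hu.exists_left_inv
    have hX : (X 3 : MvPowerSeries (Fin 4) κ) = u * (X 3 + X 3 ^ 2) := by
      rw [show (X 3 + X 3 ^ 2 : MvPowerSeries (Fin 4) κ) = (1 + X 3) * X 3 by ring, ← mul_assoc, hu',
        one_mul]
    have goal := Ideal.mul_mem_left _ u h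
    rw [← hX] at goal
    simpa using goal

/-- [OURS · L1 W4.6] **The successor is ISOLATED** (indeed `(∂a') = 𝔪`, `μ = 1`). [folklore] -/
theorem isol_step_fourMixed [CharP κ 2] {c : (Fin 4 → ℕ) → κ}
    (hc : ser 2 4 κ c = X 0 * X 1 + X 2 ^ 2 * X 3 + X 2 * X 3 ^ 2) : Isol 2 4 κ (step 2 4 κ 2 0 c) := by
  rw [isol_iff_finite_pderiv, ser_step_of_ser_eq_fourMixed hc]
  have hle : maximalIdeal (MvPowerSeries (Fin 4) κ) ^ 1 ≤ Ideal.span (Set.range fun s : Fin 4 =>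
      MvPowerSeries.pderiv s ((X 0 * X 1 + X 2 * X 3 + X 2 * X 3 ^ 2 : MvPowerSeries (Fin 4) κ))) := by
    rw [Literature.RingTheory.MvPowerSeries.Jets.maximalIdeal_pow_eq_span_monomial, Ideal.span_le]
    rintro _ ⟨e, he, rfl⟩
    change e.degree = 1 at he
    obtain ⟨t, rfl⟩ := exists_eq_single_of_degree_eq_one he
    change (monomial (Finsupp.single t 1) (1 : κ) : MvPowerSeries (Fin 4) κ) ∈ _
    rw [← X_def]
    exact X_mem_jac_fourMixedStep t
  haveI := Literature.RingTheory.MvPowerSeries.Jets.finite_quotient_maximalIdeal_pow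
    (σ := Fin 4) (K := κ) 1
  exact Module.Finite.of_surjective (Ideal.Quotient.factorₐ κ hle).toLinearMap
    (Ideal.Quotient.factor_surjective hle)

/-! ## The embedding dimensions, and the scope marker -/

/-- [OURS · L1 W4.6] **A fourfold double state with `OrdP` and a double successor has `e = 2` or `e = 0`;
with a double successor it is `e = 2`** (any field of characteristic `2`): `OrdP` gives `e ≤ 2`, parity
gives `e` even, and `e = 0` would forbid double successors (`hypersurface_not_multP_step_of_milnorEmbDim_eq_zero`).
[folklore] -/
theorem fourfold_milnorEmbDim_eq_two_of_double_successor [CharP κ 2] (c : (Fin 4 → ℕ) → κ) (i : Fin 4)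
    (τ : Fin 4 → κ) (hM : MultP 2 4 κ c) (hO : OrdP 2 4 κ c) (hM' : MultP 2 4 κ (step 2 4 κ i τ c)) :
    milnorEmbDim 2 4 κ c = 2 := by
  have h1 := (ordP_iff_milnorEmbDim_add_two_le hM).mp hO
  have h2 := (milnorEmbDim_le_and_mod_two hM).2.1
  have h3 : milnorEmbDim 2 4 κ c ≠ 0 := fun h0 =>
    hypersurface_not_multP_step_of_milnorEmbDim_eq_zero c hM h0 i τ hM'
  omega

/-- [OURS · L1 W4.6 rung (ii) at `p = 2`, HONEST SCOPE MARKER; NOT a statement of the manuscript]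
**EMBEDDING DIMENSION TWO IS GENUINELY UNDECIDED.** Over EVERY field of characteristic `2` there are two
isolated double points of fourfold hypersurfaces `z² = a(u₀,u₁,u₂,u₃)`, both order-2 cleaned with `e = 2`,
whose point-blow-up successors in chart `u₂` (no translation) are double points — one ISOLATED
(`a = u₀u₁ + u₂²u₃ + u₂u₃²`, successor `u₀u₁ + u₂u₃ + u₂u₃²` with `μ = 1`), the other NOT isolated
(`a = u₀u₁ + u₂⁵ + u₃⁵`, p485483). So in the trichotomy (`hypersurface_trichotomy`, p501990: `e ≤ 1 ⇒`
isolated successor, `e ≥ 3 ⇒` non-isolated) the middle value `e = 2` cannot be decided by `e`. [folklore] -/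
theorem fourfold_embDim_two_undecided (κ : Type) [Field κ] [CharP κ 2] :
    (∃ c : (Fin 4 → ℕ) → κ, MultP 2 4 κ c ∧ OrdP 2 4 κ c ∧ Isol 2 4 κ c ∧ milnorEmbDim 2 4 κ c = 2 ∧
        MultP 2 4 κ (step 2 4 κ 2 0 c) ∧ Isol 2 4 κ (step 2 4 κ 2 0 c)) ∧
      (∃ c : (Fin 4 → ℕ) → κ, MultP 2 4 κ c ∧ OrdP 2 4 κ c ∧ Isol 2 4 κ c ∧ milnorEmbDim 2 4 κ c = 2 ∧
        MultP 2 4 κ (step 2 4 κ 2 0 c) ∧ ¬ Isol 2 4 κ (step 2 4 κ 2 0 c)) := by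
  constructor
  · obtain ⟨c, hc⟩ := exists_ser_eq (κ := κ)
      ((X 0 * X 1 + X 2 ^ 2 * X 3 + X 2 * X 3 ^ 2 : MvPowerSeries (Fin 4) κ))
      fourMixed_coeff_eq_zero_of_even
    exact ⟨c, multP_of_ser_eq_fourMixed hc, ordP_of_ser_eq_fourMixed hc, isol_of_ser_eq_fourMixed hc,
      fourfold_milnorEmbDim_eq_two_of_double_successor c 2 0 (multP_of_ser_eq_fourMixed hc)
        (ordP_of_ser_eq_fourMixed hc) (multP_step_fourMixed hc),
      multP_step_fourMixed hc, isol_step_fourMixed hc⟩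
  · obtain ⟨c, hc⟩ := exists_ser_eq (κ := κ)
      ((X 0 * X 1 + X 2 ^ 5 + X 3 ^ 5 : MvPowerSeries (Fin 4) κ)) fourStart_coeff_eq_zero_of_even
    exact ⟨c, multP_of_ser_eq_fourStart hc, ordP_of_ser_eq_fourStart hc, isol_of_ser_eq_fourStart hc,
      fourfold_milnorEmbDim_eq_two_of_double_successor c 2 0 (multP_of_ser_eq_fourStart hc)
        (ordP_of_ser_eq_fourStart hc) (multP_step_fourStart hc),
      multP_step_fourStart hc, not_isol_step_fourStart hc⟩

end CampaignW46.HypersurfacesCharTwo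

end Summit.ResolutionOfSingularities.ResolutionOfSingularities.Theorems

end
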